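import Mathlib.Combinatorics.Enumerative.Partition.GenFun
import Mathlib.Algebra.BigOperators.Intervals
import Mathlib.Algebra.BigOperators.Field
import Mathlib.Algebra.BigOperators.Ring.Finset
import Mathlib.Algebra.Order.BigOperators.Ring.Finset
import Mathlib.Algebra.Order.Ring.Pow
import Mathlib.Data.Nat.Factorial.Basic
import Mathlib.Data.Real.Basic
import Mathlib.Tactic.FieldSimp
import Mathlib.Tactic.Linarith
import Mathlib.Tactic.Positivity
import Mathlib.Tactic.Ring
import HarnessLib

/-!
# The cycle-index sum of the symmetric group and its recursion

For a real sequence `x₁, x₂, …` the *cycle-index sum*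
`C_N(x) = ∑_{p ⊢ N} ∏_j (x_j / j)^{n_j} / n_j!` (sum over the partitions `p = (1^{n₁} 2^{n₂} ⋯)`
of `N`) is the cycle index `Z(S_N)` of the symmetric group evaluated at `x`; equivalently
`(1/N!) ∑_{g ∈ S_N} ∏_j x_j^{c_j(g)}` with `c_j(g)` the number of `j`-cycles of `g`, or the
coefficient of `s^N` in `exp(∑_j x_j s^j / j)`. In statistical mechanics it is the canonical
partition function of `N` free bosons written as a sum over permutation cycle types, with
`x_j = tr e^{-jβh}` (e.g. the `canonicalZ` of
`Literature/Barriers/AtomisticToContinuum/FeynmanCyclesVersusCondensation.lean`).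

Proved here (all elementary, [folklore]):

* `cycleIndexSum_eq_coeff_genFun`: `C_N(x)` is the `N`-th coefficient of Mathlib's partition
  generating function `Nat.Partition.genFun (fun j c => (x_j/j)^c/c!)`, whose product formula is
  `Nat.Partition.hasProd_genFun` (so `∑_N C_N(x) s^N = ∏_j exp(x_j s^j/j)` formally);
* `cycleIndexSum_rec`: the recursion `N · C_N(x) = ∑_{j=1}^{N} x_j C_{N-j}(x)` (remove the cycle
  containing a marked point; formally: Mathlib's `Nat.Partition.partitionWithPartEquiv`);
* `eq_cycleIndexSum_of_rec`: the recursion and `C_0 = 1` determine the sequence;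
* `cycleIndexSum_add_one`: `C_N(x + 1) = ∑_{m ≤ N} C_m(x)` (adding a weight-one "mode":
  `exp(∑ (x_j+1)s^j/j) = exp(∑ x_j s^j/j) · (1 - s)⁻¹`), hence `C_N(x) - C_{N-1}(x) = C_N(x - 1)`
  and monotonicity of `N ↦ C_N(x)` when all `x_j ≥ 1`;
* nonnegativity / positivity for nonnegative / positive `x`, polynomial growth
  `C_m(x) ≤ (m+1)^K` when `0 ≤ x_j ≤ K` (`K : ℕ`, which is what the consumer needs).

All hypotheses on `x` are imposed for `j > 0` only: `C_N(x)` never reads `x 0`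
(`cycleIndexSum_congr`), and in the Bose-gas application `x 0` is a junk value. Helper lemmas
live in the sub-namespace `CycleIndexSum`. Not here: analytic facts about the generating
function (radius of convergence, the Bose–Einstein product `∏_k (1 - sλ_k)⁻¹`).
-/

noncomputable section

open Finset
open scoped BigOperators

namespace Literature.Combinatorics.Enumerative

/-- The cycle-index sum `C_N(x) = ∑_{p ⊢ N} ∏_{j} (x_j/j)^{n_j(p)} / n_j(p)!`, where `n_j(p)` is the
multiplicity of the part `j` in the partition `p` of `N` (`C_0(x) = 1`). [folklore] -/
def cycleIndexSum (x : ℕ → ℝ) (N : ℕ) : ℝ :=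
  ∑ p : Nat.Partition N, ∏ j ∈ p.parts.toFinset,
    (x j / j) ^ p.parts.count j / (p.parts.count j).factorial

variable (x : ℕ → ℝ)

/-- `C_0(x) = 1`. [folklore] -/
@[simp] theorem cycleIndexSum_zero : cycleIndexSum x 0 = 1 := by
  simp [cycleIndexSum]

/-- `C_1(x) = x_1`. [folklore] -/
@[simp] theorem cycleIndexSum_one : cycleIndexSum x 1 = x 1 := by
  simp [cycleIndexSum]

/-- `C_N(x)` depends only on `x_j` for `j > 0`. [folklore] -/
theorem cycleIndexSum_congr {x x' : ℕ → ℝ} (h : ∀ j, 0 < j → x j = x' j) (N : ℕ) :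
    cycleIndexSum x N = cycleIndexSum x' N := by
  unfold cycleIndexSum
  refine Finset.sum_congr rfl fun p _ => Finset.prod_congr rfl fun j hj => ?_
  rw [h j (p.parts_pos (Multiset.mem_toFinset.mp hj))]

/-- `C_N(x)` is a coefficient of Mathlib's partition generating function:
`C_N(x) = [X^N] Nat.Partition.genFun (fun j c => (x_j/j)^c/c!)`; the product formula for the
latter is `Nat.Partition.hasProd_genFun`. [folklore] -/
theorem cycleIndexSum_eq_coeff_genFun (x : ℕ → ℝ) (N : ℕ) :
    cycleIndexSum x N =
      (Nat.Partition.genFun fun j c => (x j / j) ^ c / (c.factorial : ℝ)).coeff N := by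
  rw [Nat.Partition.coeff_genFun]
  unfold cycleIndexSum
  refine Finset.sum_congr rfl fun p _ => ?_
  simp [Finsupp.prod]

/-- `C_N(x) ≥ 0` when `x_j ≥ 0` for `j > 0`. [folklore] -/
theorem cycleIndexSum_nonneg {x : ℕ → ℝ} (hx : ∀ j, 0 < j → 0 ≤ x j) (N : ℕ) :
    0 ≤ cycleIndexSum x N := by
  unfold cycleIndexSum
  refine Finset.sum_nonneg fun p _ => Finset.prod_nonneg fun j hj => ?_
  have := hx j (p.parts_pos (Multiset.mem_toFinset.mp hj))
  positivity

/-- `C_N(x) > 0` when `x_j > 0` for `j > 0`. [folklore] -/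
theorem cycleIndexSum_pos {x : ℕ → ℝ} (hx : ∀ j, 0 < j → 0 < x j) (N : ℕ) :
    0 < cycleIndexSum x N := by
  unfold cycleIndexSum
  refine Finset.sum_pos (fun p _ => Finset.prod_pos fun j hj => ?_) Finset.univ_nonempty
  have hj : 0 < j := p.parts_pos (Multiset.mem_toFinset.mp hj)
  have := hx j hj
  positivity

namespace CycleIndexSum

/-- The weight of a partition may be computed over any finset of part sizes containing its
parts (absent parts contribute the factor `1`). [folklore] -/
theorem prod_toFinset_eq_prod_of_subset {n : ℕ} (p : Nat.Partition n) {S : Finset ℕ}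
    (hS : p.parts.toFinset ⊆ S) :
    ∏ j ∈ p.parts.toFinset, (x j / j) ^ p.parts.count j / (p.parts.count j).factorial =
      ∏ j ∈ S, (x j / j) ^ p.parts.count j / (p.parts.count j).factorial := by
  refine Finset.prod_subset hS fun j _ hj => ?_
  rw [Multiset.mem_toFinset] at hj
  simp [Multiset.count_eq_zero_of_notMem hj]

/-- The parts of a partition of `n` lie in `[1, n]`. [folklore] -/
theorem toFinset_subset_Icc {n : ℕ} (p : Nat.Partition n) : p.parts.toFinset ⊆ Finset.Icc 1 n := by
  intro j hj
  rw [Multiset.mem_toFinset] at hj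
  exact Finset.mem_Icc.mpr ⟨p.parts_pos hj, Nat.Partition.le_of_mem_parts hj⟩

/-- The single-part computation behind the recursion: marking one of the `j · n_j` points lying
in `j`-cycles and deleting its cycle turns the weight `(x_j/j)^{n_j}/n_j!` into
`x_j · (x_j/j)^{n_j - 1}/(n_j - 1)!`. [folklore] -/
theorem mul_weight_succ {j : ℕ} (hj : j ≠ 0) (c : ℕ) :
    (j : ℝ) * (c + 1 : ℕ) * ((x j / j) ^ (c + 1) / (c + 1).factorial) =
      x j * ((x j / j) ^ c / c.factorial) := by
  have hj' : (j : ℝ) ≠ 0 := by exact_mod_cast hj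
  have hc : ((c.factorial : ℕ) : ℝ) ≠ 0 := by positivity
  rw [Nat.factorial_succ, div_pow, div_pow, pow_succ, pow_succ]
  push_cast
  field_simp

end CycleIndexSum

open CycleIndexSum in
/-- **The cycle-index recursion** `N · C_N(x) = ∑_{j=1}^{N} x_j · C_{N-j}(x)`: classify the
permutation by the length `j` of the cycle through a marked point. [folklore] -/
theorem cycleIndexSum_rec (N : ℕ) :
    (N : ℝ) * cycleIndexSum x N = ∑ j ∈ Finset.Icc 1 N, x j * cycleIndexSum x (N - j) := by
  classical
  -- the weight of a partition, written over the fixed index set `[1, N]`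
  set w : Nat.Partition N → ℝ := fun p =>
    ∏ j ∈ Finset.Icc 1 N, (x j / j) ^ p.parts.count j / (p.parts.count j).factorial with hw
  have hC : cycleIndexSum x N = ∑ p : Nat.Partition N, w p := by
    unfold cycleIndexSum
    exact Finset.sum_congr rfl fun p _ => prod_toFinset_eq_prod_of_subset x p (toFinset_subset_Icc p)
  -- `N = ∑_{j ∈ [1,N]} j · n_j(p)` for every partition `p`
  have hN : ∀ p : Nat.Partition N, (N : ℝ) = ∑ j ∈ Finset.Icc 1 N, (j : ℝ) * p.parts.count j := by
    intro p
    have h := Finset.sum_multiset_count_of_subset p.parts (Finset.Icc 1 N) (toFinset_subset_Icc p)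
    rw [p.parts_sum] at h
    simp only [smul_eq_mul] at h
    have h' : (N : ℝ) = ∑ i ∈ Finset.Icc 1 N, ((p.parts.count i : ℝ) * (i : ℝ)) := by
      exact_mod_cast h
    rw [h']
    exact Finset.sum_congr rfl fun j _ => mul_comm _ _
  -- rewrite the left-hand side as a double sum and exchange
  have hL : (N : ℝ) * cycleIndexSum x N =
      ∑ j ∈ Finset.Icc 1 N, ∑ p : Nat.Partition N, (j : ℝ) * p.parts.count j * w p := by
    rw [hC, Finset.mul_sum]
    have : ∀ p : Nat.Partition N, (N : ℝ) * w p =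
        ∑ j ∈ Finset.Icc 1 N, (j : ℝ) * p.parts.count j * w p := fun p => by
      rw [hN p, Finset.sum_mul]
    rw [Finset.sum_congr rfl fun p _ => this p, Finset.sum_comm]
  rw [hL]
  refine Finset.sum_congr rfl fun j hj => ?_
  obtain ⟨hj1, hjN⟩ := Finset.mem_Icc.mp hj
  -- only partitions containing the part `j` contribute
  have hzero : ∀ p : Nat.Partition N, p ∉ Finset.univ.filter (fun p : Nat.Partition N => j ∈ p.parts) →
      (j : ℝ) * p.parts.count j * w p = 0 := by
    intro p hp
    have : j ∉ p.parts := by simpa using hp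
    simp [Multiset.count_eq_zero_of_notMem this]
  rw [← Finset.sum_subset (Finset.subset_univ _) fun p _ hp => hzero p hp]
  rw [Finset.sum_subtype (Finset.univ.filter fun p : Nat.Partition N => j ∈ p.parts)
    (p := fun p : Nat.Partition N => j ∈ p.parts) (fun p => by simp)]
  -- reindex by partitions of `N - j`
  let e := Nat.Partition.partitionWithPartEquiv (n := N) (a := j) hj1 hjN
  rw [← e.symm.sum_comp]
  -- compare term by term with `x j * C_{N-j}`
  have hCj : cycleIndexSum x (N - j) = ∑ q : Nat.Partition (N - j),
      ∏ i ∈ Finset.Icc 1 N, (x i / i) ^ q.parts.count i / (q.parts.count i).factorial := by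
    unfold cycleIndexSum
    refine Finset.sum_congr rfl fun q _ => prod_toFinset_eq_prod_of_subset x q ?_
    exact (toFinset_subset_Icc q).trans (Finset.Icc_subset_Icc_right (Nat.sub_le N j))
  rw [hCj, Finset.mul_sum]
  refine Finset.sum_congr rfl fun q _ => ?_
  have hparts : (e.symm q).1.parts = j ::ₘ q.parts :=
    Nat.Partition.partitionWithPartEquiv_symm_apply_parts hj1 hjN q
  simp only [hw, hparts]
  rw [← Finset.mul_prod_erase _ _ hj, ← Finset.mul_prod_erase _ _ hj]
  have hrest : ∏ i ∈ (Finset.Icc 1 N).erase j,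
      (x i / i) ^ (j ::ₘ q.parts).count i / ((j ::ₘ q.parts).count i).factorial =
      ∏ i ∈ (Finset.Icc 1 N).erase j, (x i / i) ^ q.parts.count i / (q.parts.count i).factorial := by
    refine Finset.prod_congr rfl fun i hi => ?_
    rw [Multiset.count_cons_of_ne (Finset.ne_of_mem_erase hi)]
  rw [hrest, Multiset.count_cons_self]
  have hj0 : j ≠ 0 := by omega
  have key := mul_weight_succ x hj0 (q.parts.count j)
  rw [← mul_assoc, ← mul_assoc, key]

/-- **Uniqueness for the recursion**: a sequence with `Z_0 = 1` and
`N · Z_N = ∑_{j=1}^{N} x_j Z_{N-j}` for `N ≥ 1` is the cycle-index sum. [folklore] -/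
theorem eq_cycleIndexSum_of_rec {Z : ℕ → ℝ} (h0 : Z 0 = 1)
    (hrec : ∀ N : ℕ, 1 ≤ N → (N : ℝ) * Z N = ∑ j ∈ Finset.Icc 1 N, x j * Z (N - j)) :
    Z = cycleIndexSum x := by
  funext N
  induction N using Nat.strong_induction_on with
  | _ N ih =>
    rcases Nat.eq_zero_or_pos N with rfl | hN
    · simp [h0]
    · have h1 := hrec N hN
      have h2 := cycleIndexSum_rec x N
      have h3 : ∑ j ∈ Finset.Icc 1 N, x j * Z (N - j) =
          ∑ j ∈ Finset.Icc 1 N, x j * cycleIndexSum x (N - j) := by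
        refine Finset.sum_congr rfl fun j hj => ?_
        obtain ⟨hj1, -⟩ := Finset.mem_Icc.mp hj
        rw [ih (N - j) (by omega)]
      have hN' : (N : ℝ) ≠ 0 := by positivity
      apply mul_left_cancel₀ hN'
      rw [h1, h3, h2]

namespace CycleIndexSum

/-- Summation by parts for the recursion kernel: `∑_{m ≤ N} ∑_{j=1}^{m} f_j g_{m-j} =
∑_{j=1}^{N} f_j ∑_{i ≤ N-j} g_i`. [folklore] -/
theorem sum_range_sum_Icc_eq (f g : ℕ → ℝ) (N : ℕ) :
    ∑ m ∈ Finset.range (N + 1), ∑ j ∈ Finset.Icc 1 m, f j * g (m - j) =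
      ∑ j ∈ Finset.Icc 1 N, f j * ∑ i ∈ Finset.range (N - j + 1), g i := by
  induction N with
  | zero => simp
  | succ N ih =>
    rw [Finset.sum_range_succ, ih, Finset.sum_Icc_succ_top (by omega : 1 ≤ N + 1),
      Finset.sum_Icc_succ_top (by omega : 1 ≤ N + 1)]
    have h1 : ∑ j ∈ Finset.Icc 1 N, f j * ∑ i ∈ Finset.range (N + 1 - j + 1), g i =
        ∑ j ∈ Finset.Icc 1 N, f j * ∑ i ∈ Finset.range (N - j + 1), g i +
          ∑ j ∈ Finset.Icc 1 N, f j * g (N + 1 - j) := by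
      rw [← Finset.sum_add_distrib]
      refine Finset.sum_congr rfl fun j hj => ?_
      obtain ⟨-, hjN⟩ := Finset.mem_Icc.mp hj
      rw [show N + 1 - j + 1 = (N - j + 1) + 1 by omega, Finset.sum_range_succ,
        show N - j + 1 = N + 1 - j by omega]
      ring
    rw [h1]
    simp only [Nat.sub_self, zero_add, Finset.sum_range_one]
    ring

/-- `∑_{j=1}^{N} ∑_{i ≤ N-j} g_i = ∑_{m ≤ N} (N - m) g_m`. [folklore] -/
theorem sum_Icc_sum_range_eq (g : ℕ → ℝ) (N : ℕ) :
    ∑ j ∈ Finset.Icc 1 N, ∑ i ∈ Finset.range (N - j + 1), g i =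
      ∑ m ∈ Finset.range (N + 1), ((N : ℝ) - m) * g m := by
  induction N with
  | zero => simp
  | succ N ih =>
    rw [Finset.sum_Icc_succ_top (by omega : 1 ≤ N + 1)]
    have h1 : ∑ j ∈ Finset.Icc 1 N, ∑ i ∈ Finset.range (N + 1 - j + 1), g i =
        ∑ j ∈ Finset.Icc 1 N, ∑ i ∈ Finset.range (N - j + 1), g i +
          ∑ j ∈ Finset.Icc 1 N, g (N + 1 - j) := by
      rw [← Finset.sum_add_distrib]
      refine Finset.sum_congr rfl fun j hj => ?_
      obtain ⟨-, hjN⟩ := Finset.mem_Icc.mp hj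
      rw [show N + 1 - j + 1 = (N - j + 1) + 1 by omega, Finset.sum_range_succ,
        show N - j + 1 = N + 1 - j by omega]
    -- `∑_{j=1}^{N} g (N+1-j) = ∑_{m=1}^{N} g m`, reindexing `m = N + 1 - j`
    have h2 : ∑ j ∈ Finset.Icc 1 N, g (N + 1 - j) = ∑ m ∈ Finset.range N, g (m + 1) := by
      have hI : Finset.Icc 1 N = Finset.Ico 1 (N + 1) := rfl
      rw [hI, Finset.sum_Ico_eq_sum_range, show N + 1 - 1 = N from rfl,
        ← Finset.sum_range_reflect]
      refine Finset.sum_congr rfl fun m hm => ?_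
      have := Finset.mem_range.mp hm
      congr 1
      omega
    rw [h1, ih, h2]
    simp only [Nat.sub_self, zero_add, Finset.sum_range_one]
    rw [add_assoc, ← Finset.sum_range_succ' g N, ← Finset.sum_add_distrib]
    conv_rhs => rw [Finset.sum_range_succ]
    simp only [sub_self, zero_mul, add_zero]
    refine Finset.sum_congr rfl fun m _ => ?_
    push_cast
    ring

/-- Reindexing `j ↦ N - j` on `[1, N]`. [folklore] -/
theorem sum_Icc_one_sub_eq_sum_range (f : ℕ → ℝ) (N : ℕ) :
    ∑ j ∈ Finset.Icc 1 N, f (N - j) = ∑ i ∈ Finset.range N, f i := by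
  have hI : Finset.Icc 1 N = Finset.Ico 1 (N + 1) := rfl
  rw [hI, Finset.sum_Ico_eq_sum_range, show N + 1 - 1 = N from rfl, ← Finset.sum_range_reflect]
  refine Finset.sum_congr rfl fun m hm => ?_
  have := Finset.mem_range.mp hm
  congr 1
  omega

end CycleIndexSum

open CycleIndexSum in
/-- **Adding a unit mode**: `C_N(x + 1) = ∑_{m ≤ N} C_m(x)`; in generating functions,
`exp(∑_j (x_j + 1) s^j / j) = exp(∑_j x_j s^j / j) · (1 - s)⁻¹`. [folklore] -/
theorem cycleIndexSum_add_one (N : ℕ) :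
    cycleIndexSum (fun j => x j + 1) N = ∑ m ∈ Finset.range (N + 1), cycleIndexSum x m := by
  have key : (fun N => ∑ m ∈ Finset.range (N + 1), cycleIndexSum x m) =
      cycleIndexSum (fun j => x j + 1) := by
    refine eq_cycleIndexSum_of_rec (fun j => x j + 1) (by simp) fun (N : ℕ) _ => ?_
    -- `N · S_N = ∑_{m ≤ N} m C_m + ∑_{m ≤ N} (N - m) C_m`
    have hsplit : (N : ℝ) * ∑ m ∈ Finset.range (N + 1), cycleIndexSum x m =
        ∑ m ∈ Finset.range (N + 1), (m : ℝ) * cycleIndexSum x m +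
          ∑ m ∈ Finset.range (N + 1), ((N : ℝ) - m) * cycleIndexSum x m := by
      rw [Finset.mul_sum, ← Finset.sum_add_distrib]
      exact Finset.sum_congr rfl fun m _ => by ring
    have hA : ∑ m ∈ Finset.range (N + 1), (m : ℝ) * cycleIndexSum x m =
        ∑ j ∈ Finset.Icc 1 N, x j * ∑ i ∈ Finset.range (N - j + 1), cycleIndexSum x i := by
      rw [← sum_range_sum_Icc_eq]
      exact Finset.sum_congr rfl fun m _ => cycleIndexSum_rec x m
    rw [hsplit, hA, ← sum_Icc_sum_range_eq, ← Finset.sum_add_distrib]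
    exact Finset.sum_congr rfl fun j _ => by ring
  exact (congrFun key N).symm

/-- `C_N(x) - C_{N-1}(x) = C_N(x - 1)` for `N ≥ 1`: the "zero-mode-removed" sums are the
increments. [folklore] -/
theorem cycleIndexSum_sub_one_eq (N : ℕ) :
    cycleIndexSum (fun j => x j - 1) (N + 1) = cycleIndexSum x (N + 1) - cycleIndexSum x N := by
  have h1 := cycleIndexSum_add_one (fun j => x j - 1) (N + 1)
  have h2 := cycleIndexSum_add_one (fun j => x j - 1) N
  simp only [sub_add_cancel] at h1 h2
  rw [h1, h2, Finset.sum_range_succ]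
  ring

/-- `C_N(x) = ∑_{m ≤ N} C_m(x - 1)`. [folklore] -/
theorem cycleIndexSum_eq_sum_sub_one (N : ℕ) :
    cycleIndexSum x N = ∑ m ∈ Finset.range (N + 1), cycleIndexSum (fun j => x j - 1) m := by
  have h := cycleIndexSum_add_one (fun j => x j - 1) N
  simp only [sub_add_cancel] at h
  exact h

/-- If `x_j ≥ 1` for `j > 0` then `N ↦ C_N(x)` is non-decreasing. [folklore] -/
theorem cycleIndexSum_mono {x : ℕ → ℝ} (hx : ∀ j, 0 < j → 1 ≤ x j) :
    Monotone (cycleIndexSum x) := by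
  refine monotone_nat_of_le_succ fun N => ?_
  have h := cycleIndexSum_sub_one_eq x N
  have h0 : 0 ≤ cycleIndexSum (fun j => x j - 1) (N + 1) :=
    cycleIndexSum_nonneg (fun j hj => sub_nonneg.mpr (hx j hj)) _
  linarith

namespace CycleIndexSum

/-- The recursion divided through: for `C_N(x) ≠ 0`,
`N - ∑_{i=1}^{N} C_{N-i}/C_N = ∑_{j=1}^{N} (x_j - 1) C_{N-j}/C_N` (in the Bose gas: the mean
number of particles outside the zero mode). [folklore] -/
theorem sub_sum_ratio_eq (N : ℕ) (hC : cycleIndexSum x N ≠ 0) :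
    (N : ℝ) - ∑ i ∈ Finset.Icc 1 N, cycleIndexSum x (N - i) / cycleIndexSum x N =
      ∑ j ∈ Finset.Icc 1 N, (x j - 1) * (cycleIndexSum x (N - j) / cycleIndexSum x N) := by
  have h := cycleIndexSum_rec x N
  have h' : (N : ℝ) = ∑ j ∈ Finset.Icc 1 N, x j * (cycleIndexSum x (N - j) / cycleIndexSum x N) := by
    have : (N : ℝ) = (N : ℝ) * cycleIndexSum x N / cycleIndexSum x N := by field_simp
    rw [this, h, Finset.sum_div]
    exact Finset.sum_congr rfl fun j _ => by ring
  rw [h', ← Finset.sum_sub_distrib]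
  exact Finset.sum_congr rfl fun j _ => by ring

/-- **Mean excitation bound**: if `x_j ≥ 1` for `j > 0` (so that `C_·(x)` is positive and
non-decreasing), then `N - ∑_{i=1}^{N} C_{N-i}/C_N ≤ ∑_{j=1}^{N} (x_j - 1)` (in the free Bose
gas: the mean number of excited particles is at most `∑_{k ≠ 0} (e^{βε_k} - 1)⁻¹`).
[folklore] -/
theorem sub_sum_ratio_le {x : ℕ → ℝ} (hx : ∀ j, 0 < j → 1 ≤ x j) (N : ℕ) :
    (N : ℝ) - ∑ i ∈ Finset.Icc 1 N, cycleIndexSum x (N - i) / cycleIndexSum x N ≤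
      ∑ j ∈ Finset.Icc 1 N, (x j - 1) := by
  have hpos : ∀ n, 0 < cycleIndexSum x n :=
    cycleIndexSum_pos fun j hj => lt_of_lt_of_le one_pos (hx j hj)
  rw [sub_sum_ratio_eq x N (hpos N).ne']
  refine Finset.sum_le_sum fun j hj => ?_
  obtain ⟨hj1, -⟩ := Finset.mem_Icc.mp hj
  have h1 : cycleIndexSum x (N - j) / cycleIndexSum x N ≤ 1 := by
    rw [div_le_one (hpos N)]
    exact cycleIndexSum_mono hx (Nat.sub_le N j)
  have h2 : 0 ≤ x j - 1 := sub_nonneg.mpr (hx j hj1)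
  nlinarith

end CycleIndexSum

open CycleIndexSum in
/-- **Polynomial growth**: if `0 ≤ x_j ≤ K` for `j > 0` (with a natural-number bound `K`, which
is all the consumer needs) then `∑_{i ≤ m} C_i(x) ≤ (m + 1)^K` (from the recursion,
`S_m ≤ S_{m-1}(1 + K/m)`, and Bernoulli's inequality). [folklore] -/
theorem sum_cycleIndexSum_le_pow {x : ℕ → ℝ} {K : ℕ} (hx0 : ∀ j, 0 < j → 0 ≤ x j)
    (hxK : ∀ j, 0 < j → x j ≤ K) (m : ℕ) :
    ∑ i ∈ Finset.range (m + 1), cycleIndexSum x i ≤ ((m : ℝ) + 1) ^ K := by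
  induction m with
  | zero => simp
  | succ m ih =>
    have hS0 : 0 ≤ ∑ i ∈ Finset.range (m + 1), cycleIndexSum x i :=
      Finset.sum_nonneg fun i _ => cycleIndexSum_nonneg hx0 i
    have hm : (0 : ℝ) < (m : ℝ) + 1 := by positivity
    -- `(m+1) C_{m+1} ≤ K S_m`
    have hC : ((m : ℝ) + 1) * cycleIndexSum x (m + 1) ≤
        K * ∑ i ∈ Finset.range (m + 1), cycleIndexSum x i := by
      have hcast : ((m : ℝ) + 1) = ((m + 1 : ℕ) : ℝ) := by push_cast; ring
      rw [hcast, cycleIndexSum_rec x (m + 1), ← sum_Icc_one_sub_eq_sum_range (cycleIndexSum x) (m + 1),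
        Finset.mul_sum]
      refine Finset.sum_le_sum fun j hj => ?_
      obtain ⟨hj1, -⟩ := Finset.mem_Icc.mp hj
      exact mul_le_mul_of_nonneg_right (hxK j hj1) (cycleIndexSum_nonneg hx0 _)
    have hB : 1 + (K : ℝ) / ((m : ℝ) + 1) ≤ (1 + 1 / ((m : ℝ) + 1)) ^ K := by
      have h := one_add_mul_le_pow (a := 1 / ((m : ℝ) + 1))
        (by have : (0 : ℝ) ≤ 1 / ((m : ℝ) + 1) := by positivity
            linarith) K
      calc 1 + (K : ℝ) / ((m : ℝ) + 1) = 1 + (K : ℝ) * (1 / ((m : ℝ) + 1)) := by ring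
        _ ≤ (1 + 1 / ((m : ℝ) + 1)) ^ K := h
    rw [Finset.sum_range_succ]
    calc ∑ i ∈ Finset.range (m + 1), cycleIndexSum x i + cycleIndexSum x (m + 1)
        ≤ (1 + K / ((m : ℝ) + 1)) * ∑ i ∈ Finset.range (m + 1), cycleIndexSum x i := by
          rw [add_mul, one_mul, add_le_add_iff_left, div_mul_eq_mul_div, le_div_iff₀ hm]
          linarith
      _ ≤ (1 + 1 / ((m : ℝ) + 1)) ^ K * ((m : ℝ) + 1) ^ K := by gcongr
      _ = (((m + 1 : ℕ) : ℝ) + 1) ^ K := by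
          rw [← mul_pow]
          congr 1
          push_cast
          field_simp

/-- `C_m(x) ≤ (m + 1)^K` when `0 ≤ x_j ≤ K` (`K : ℕ`) for `j > 0`. [folklore] -/
theorem cycleIndexSum_le_pow {x : ℕ → ℝ} {K : ℕ} (hx0 : ∀ j, 0 < j → 0 ≤ x j)
    (hxK : ∀ j, 0 < j → x j ≤ K) (m : ℕ) : cycleIndexSum x m ≤ ((m : ℝ) + 1) ^ K := by
  refine le_trans ?_ (sum_cycleIndexSum_le_pow hx0 hxK m)
  exact Finset.single_le_sum (f := cycleIndexSum x) (fun i _ => cycleIndexSum_nonneg hx0 i)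
    (Finset.self_mem_range_succ m)

end Literature.Combinatorics.Enumerative

end
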